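import Mathlib
import HarnessLib
import Literature.Analysis.FluidPDE.VorticityCalculus
import Literature.Analysis.FluidPDE.BiotSavartCurlPair

/-!
# Crux `IsobarTomography.BlobRiccatiClosure` (stmt-NavierStokesRegularity-11740), line
# `type-i-apex-liouville` — the Leibniz rule `curl (χ W) = χ curl W + ∇χ × W`

Helper file (theorems only) `--supports` the item (registered stub `stub_curlSmul`). The
div–curl tomography of the velocity gradient behind the apex scale floor localises a field `W`
with a cutoff `χ` and feeds `f = curl (χ W)` — a compactly supported, divergence-free vorticity —
to the tree's Biot–Savart potential estimates; its size is read off the Leibniz rule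
`curl (χ W)(x) = χ(x) curl W(x) + ∇χ(x) × W(x)` (Majda–Bertozzi, §1.1, vector identities), which
is the tree's basis-free `curl_smul` (`VorticityCalculus`) with the rank-one term identified as a
cross product (`fderiv_eq_innerSL_gradient`, `curlCLM_smulRight_innerSL`).
-/

noncomputable section

open scoped RealInnerProductSpace

-- the summit and its single sub-problem share the name (CONVENTIONS §1), as in every Theorems file
set_option linter.dupNamespace false

namespace Summit.NavierStokesRegularity.NavierStokesRegularity.Theorems.BlobRiccatiClosure.TypeIApexLiouville

open Literature.Analysis Literature.Analysis.FluidPDE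

/-- **Leibniz rule for the curl with the cross product** (registered stub `stub_curlSmul`):
for a scalar `χ` and a field `W` differentiable at `x`,
`curl (χ W)(x) = χ(x) • curl W(x) + ∇χ(x) × W(x)` (Majda–Bertozzi, *Vorticity and
Incompressible Flow* (2002), §1.1, vector identities). [folklore] -/
theorem stub_curlSmul : ∀ (χ : EuclideanSpace ℝ (Fin 3) → ℝ) (W : EuclideanSpace ℝ (Fin 3) → EuclideanSpace ℝ (Fin 3)) (x : EuclideanSpace ℝ (Fin 3)), DifferentiableAt ℝ χ x → DifferentiableAt ℝ W x → curl (fun y => χ y • W y) x = χ x • curl W x + cross (gradient χ x) (W x) := by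
  intro χ W x hχ hW
  rw [curl_smul hχ hW, fderiv_eq_innerSL_gradient, curlCLM_smulRight_innerSL]

end Summit.NavierStokesRegularity.NavierStokesRegularity.Theorems.BlobRiccatiClosure.TypeIApexLiouville

end
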